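import Summits.HodgeConjecture.HodgeConjecture.Theorems.TropicalKugaSatakeCayleyEffectiveCayleyNonRealizabilitySixthDirectionCriterion
import Summits.HodgeConjecture.HodgeConjecture.Theorems.TropicalKugaSatakeCayleyEffectiveCayleyNonRealizabilityOfFormalCoreRigidity
import HarnessLib

/-!
# The crux `EffectiveCayleyNonRealizability` (stmt-HodgeConjecture-18569) is EQUIVALENT to
# sixth-direction vanishing for effective formal cycles of the Kuga–Satake family

Route `TropicalKugaSatakeCayley` of `HodgeConjecture`, line `formal_rational`. With
`effectiveCayleyNonRealizability_iff_formalCoreRigidity` (`…OfFormalCoreRigidity`: the crux is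
equivalent to its transferred core `stub_formalCoreRigidity`) and the sixth-direction criterion
(`…SixthDirectionCriterion`: a rational class of the class space `K` of `F_KS` killed also by
`eigenwave ∘ compound 2 B₆` is a multiple of `1`), the crux K1 becomes ONE family of linear identities
on ONE kind of finite object:

`EffectiveCayleyNonRealizability ↔` for every affine-linear formal framed `2`-chain `𝒵` over
`ℚ[t₀,…,t₄]` that is formally a cycle of the family and is effective with constant rational period
class `Mq` on a non-empty open subset of the cone, `eigenwave (compound 2 B₆ · Mq) = 0`
(`effectiveCayleyNonRealizability_iff_sixthDirectionVanishing`), where `B₆ = D R₂R₃R₄R₅` is the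
sixth direction of `F₊ = F_KS ⊕ ℚ B₆`. The easy half uses `eigenwave (compound 2 B) = 0` for every
SYMMETRIC `B` (`eigenwave_compound_two_of_transpose_eq`, any `g`, any commutative ring: the class
`1 ↔ θ^{g-2}` is a Hodge class of every torus), proved from the position-free entry formula of
`…SixthDirectionKernelReduction`.

No definition, no named fact, no sorry.
References: [MikhalkinZharkov2014Eigenwave] G. Mikhalkin, I. Zharkov, Tropical eigenwave and
intermediate Jacobians, LN UMI 15 (2014), Thm. 5.4; [Zharkov2020TropicalWeil] I. Zharkov,
arXiv:2002.02347, pp. 2–3.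
-/

noncomputable section

-- `Summit.HodgeConjecture.HodgeConjecture.…` is the mandated namespace (single-conjunct summit).
set_option linter.dupNamespace false

open scoped BigOperators Matrix

namespace Summit.HodgeConjecture.HodgeConjecture.Theorems.EffectiveCayleyNonRealizability

open Literature.AlgebraicGeometry.Tropical
open Literature.AlgebraicGeometry.Tropical.TropicalTorus
open Summit.HodgeConjecture.HodgeConjecture.Theorems.TropicalKugaSatakeCayley
open Summit.HodgeConjecture.HodgeConjecture.Theses.TropicalKugaSatakeCayley

section Symmetric

variable {S : Type*} [CommRing S] {g : ℕ}

/-- Two increasing pairs with the same underlying set coincide. [folklore] -/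
theorem pair_eq_pair_of_lt {x x' j j' : Fin g} (hx : x < x') (hj : j < j')
    (h : ({x, x'} : Finset (Fin g)) = {j, j'}) : x = j ∧ x' = j' := by
  have hxm : x ∈ ({j, j'} : Finset (Fin g)) := h ▸ Finset.mem_insert_self x {x'}
  have hx'm : x' ∈ ({j, j'} : Finset (Fin g)) :=
    h ▸ Finset.mem_insert_of_mem (Finset.mem_singleton_self x')
  simp only [Finset.mem_insert, Finset.mem_singleton] at hxm hx'm
  rcases hxm with h₁ | h₁
  · refine ⟨h₁, ?_⟩
    rcases hx'm with h₂ | h₂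
    · exact absurd (h₁.trans h₂.symm) hx.ne
    · exact h₂
  · exfalso
    rcases hx'm with h₂ | h₂
    · have hlt : x' < x := by rw [h₁, h₂]; exact hj
      exact lt_asymm hx hlt
    · exact hx.ne (h₁.trans h₂.symm)

/-- **The eigenwave kills `compound 2 B` for symmetric `B`** — the theta class `1` is a tropical
Hodge class of every torus `ℝ^g / B ℤ^g` (position-free form: the cyclic sums of the antisymmetric
reading of `1` against a symmetric matrix cancel). [cite: MikhalkinZharkov2014Eigenwave, Thm. 5.4] -/
theorem eigenwave_compound_two_of_transpose_eq (B : Matrix (Fin g) (Fin g) S)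
    (hB : B.transpose = B) : eigenwave (q := 1) (compound 2 B) = 0 := by
  classical
  have hsym : ∀ a b : Fin g, B a b = B b a := fun a b => by
    rw [← Matrix.transpose_apply B b a, hB]
  -- Kronecker delta and the antisymmetric reading of `1`
  let e : Fin g → Fin g → S := fun a b => if a = b then 1 else 0
  let N : Fin g → Fin g → Fin g → Fin g → S := fun x x' j j' => e x j * e x' j' - e x j' * e x' j
  have hN : ∀ (x x' j j' : Fin g) (hx : x < x') (hj : j < j'),
      N x x' j j' = (1 : Matrix (Sub g 2) (Sub g 2) S) ⟨{x, x'}, Finset.card_pair hx.ne⟩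
        ⟨{j, j'}, Finset.card_pair hj.ne⟩ := by
    intro x x' j j' hx hj
    have h2 : e x j' * e x' j = 0 := by
      by_cases hxj' : x = j'
      · have hne : x' ≠ j := fun h => lt_asymm hx (by rw [hxj', h]; exact hj)
        simp only [e, if_neg hne, mul_zero]
      · simp only [e, if_neg hxj', zero_mul]
    by_cases hIJ : (⟨{x, x'}, Finset.card_pair hx.ne⟩ : Sub g 2) = ⟨{j, j'}, Finset.card_pair hj.ne⟩
    · obtain ⟨hxj, hx'j'⟩ := pair_eq_pair_of_lt hx hj (congrArg Subtype.val hIJ)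
      rw [hIJ, Matrix.one_apply_eq]
      subst hxj; subst hx'j'
      show e x x * e x' x' - e x x' * e x' x = 1
      rw [h2, sub_zero]
      simp only [e, if_true, mul_one]
    · rw [Matrix.one_apply_ne hIJ]
      have h1 : e x j * e x' j' = 0 := by
        by_cases hxj : x = j
        · have hne : x' ≠ j' := by
            intro h; apply hIJ; subst hxj; subst h; rfl
          simp only [e, if_neg hne, mul_zero]
        · simp only [e, if_neg hxj, zero_mul]
      show e x j * e x' j' - e x j' * e x' j = 0
      rw [h1, h2, sub_zero]
  have ha₁ : ∀ x x' j j', N x' x j j' = -N x x' j j' := by intro x x' j j'; simp only [N]; ring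
  have hd₁ : ∀ x j j', N x x j j' = 0 := by intro x j j'; simp only [N]; ring
  have ha₂ : ∀ x x' j j', N x x' j' j = -N x x' j j' := by intro x x' j j'; simp only [N]; ring
  -- row sums against the Kronecker reading
  have hcol : ∀ k c : Fin g, ∑ x', B k x' * e x' c = B k c := by
    intro k c
    simp only [e, mul_ite, mul_one, mul_zero, Finset.sum_ite_eq', Finset.mem_univ, if_true]
  have hrow : ∀ k x j j' : Fin g, ∑ x', B k x' * N x x' j j' = e x j * B k j' - e x j' * B k j := by
    intro k x j j'
    have e1 : ∀ x', B k x' * N x x' j j' =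
        e x j * (B k x' * e x' j') - e x j' * (B k x' * e x' j) := fun x' => by
      simp only [N]; ring
    simp only [e1, Finset.sum_sub_distrib, ← Finset.mul_sum, hcol]
  ext K J
  obtain ⟨a, ha⟩ := Finset.card_eq_one.1 K.2
  have hK : K = ⟨{a}, by rw [Finset.card_singleton]⟩ := Subtype.ext ha
  rw [hK, Matrix.zero_apply, ← Matrix.mul_one (compound 2 B),
    eigenwave_compound_two_mul_apply B 1 N hN ha₁ hd₁ ha₂ a _ J]
  simp only [hrow, hsym (J.1.orderEmbOfFin J.2 1) (J.1.orderEmbOfFin J.2 0),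
    hsym (J.1.orderEmbOfFin J.2 2) (J.1.orderEmbOfFin J.2 0),
    hsym (J.1.orderEmbOfFin J.2 2) (J.1.orderEmbOfFin J.2 1)]
  rw [neg_eq_zero]
  refine Finset.sum_eq_zero fun x _ => ?_
  ring

end Symmetric

/-- The sixth direction `B₆ = D R₂R₃R₄R₅` is symmetric. [folklore] -/
theorem ksSixth_transpose :
    (ksBase * ksClifford 0 * ksClifford 1 * ksClifford 2 * ksClifford 3).transpose =
      ksBase * ksClifford 0 * ksClifford 1 * ksClifford 2 * ksClifford 3 := by
  rw [ksSixth_eq_lit]; decide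

/-- The eigenwave of the sixth direction kills the theta line `ℚ • 1`. [folklore] -/
theorem eigenwave_compound_sixth_smul_one (r : ℚ) :
    eigenwave (q := 1) (compound 2
      ((ksBase * ksClifford 0 * ksClifford 1 * ksClifford 2 * ksClifford 3).map (Int.cast : ℤ → ℚ)) *
        (r • (1 : Matrix (Sub 8 2) (Sub 8 2) ℚ))) = 0 := by
  rw [Matrix.mul_smul, Matrix.mul_one, eigenwave_smul, eigenwave_compound_two_of_transpose_eq, smul_zero]
  rw [← Matrix.transpose_map, ksSixth_transpose]

/-- **The converse half**: `stub_formalCoreRigidity` implies sixth-direction vanishing (a class in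
`ℚ • 1` is killed by every symmetric direction). [folklore] -/
theorem sixthDirectionVanishing_of_formalCoreRigidity
    (h₃ : ∀ 𝒵 : Chain (MvPolynomial (Fin 5) ℚ) 8 2, 𝒵.IsAffineLinear → 𝒵.IsCycle ksMatrixPoly →
      ∀ V : Set (Fin 5 → ℝ), IsOpen V → V.Nonempty → V ⊆ ksPosCone →
        ∀ Mq : Matrix (Sub 8 2) (Sub 8 2) ℚ,
          (∀ t ∈ V, (evalChain t 𝒵).Effective ∧
            compound 2 (ksMatrix t)⁻¹ * (evalChain t 𝒵).classOf = Mq.map (algebraMap ℚ ℝ)) →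
          ∃ r : ℚ, Mq = r • (1 : Matrix (Sub 8 2) (Sub 8 2) ℚ)) :
    ∀ 𝒵 : Chain (MvPolynomial (Fin 5) ℚ) 8 2, 𝒵.IsAffineLinear → 𝒵.IsCycle ksMatrixPoly →
      ∀ V : Set (Fin 5 → ℝ), IsOpen V → V.Nonempty → V ⊆ ksPosCone →
        ∀ Mq : Matrix (Sub 8 2) (Sub 8 2) ℚ,
          (∀ t ∈ V, (evalChain t 𝒵).Effective ∧
            compound 2 (ksMatrix t)⁻¹ * (evalChain t 𝒵).classOf = Mq.map (algebraMap ℚ ℝ)) →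
          eigenwave (q := 1) (compound 2
            ((ksBase * ksClifford 0 * ksClifford 1 * ksClifford 2 * ksClifford 3).map
              (Int.cast : ℤ → ℚ)) * Mq) = 0 := by
  intro 𝒵 hlin hcyc V hVo hVne hVcone Mq hV
  obtain ⟨r, rfl⟩ := h₃ 𝒵 hlin hcyc V hVo hVne hVcone Mq hV
  exact eigenwave_compound_sixth_smul_one r

/-- **THE CRUX AS ONE LINEAR CONDITION ON ONE FINITE OBJECT.** `EffectiveCayleyNonRealizability`
(K1 of route `TropicalKugaSatakeCayley`) holds if and only if, for every affine-linear formal framed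
`2`-chain `𝒵` over `ℚ[t₀,…,t₄]` that is formally a cycle of the Kuga–Satake family and is effective
with constant rational period class `Mq` on a non-empty open subset of the positive cone, the class is
killed by the eigenwave of the SIXTH direction: `eigenwave (compound 2 B₆ · Mq) = 0`
(`B₆ = D R₂R₃R₄R₅`). [cite: MikhalkinZharkov2014Eigenwave, Thm. 5.4]
[cite: Zharkov2020TropicalWeil, pp. 2–3] -/
theorem effectiveCayleyNonRealizability_iff_sixthDirectionVanishing :
    EffectiveCayleyNonRealizability ↔
      ∀ 𝒵 : Chain (MvPolynomial (Fin 5) ℚ) 8 2, 𝒵.IsAffineLinear → 𝒵.IsCycle ksMatrixPoly →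
        ∀ V : Set (Fin 5 → ℝ), IsOpen V → V.Nonempty → V ⊆ ksPosCone →
          ∀ Mq : Matrix (Sub 8 2) (Sub 8 2) ℚ,
            (∀ t ∈ V, (evalChain t 𝒵).Effective ∧
              compound 2 (ksMatrix t)⁻¹ * (evalChain t 𝒵).classOf = Mq.map (algebraMap ℚ ℝ)) →
            eigenwave (q := 1) (compound 2
              ((ksBase * ksClifford 0 * ksClifford 1 * ksClifford 2 * ksClifford 3).map
                (Int.cast : ℤ → ℚ)) * Mq) = 0 := by
  rw [effectiveCayleyNonRealizability_iff_formalCoreRigidity]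
  exact ⟨fun h => sixthDirectionVanishing_of_formalCoreRigidity h,
    fun h => formalCoreRigidity_of_sixthDirectionVanishing h⟩

end Summit.HodgeConjecture.HodgeConjecture.Theorems.EffectiveCayleyNonRealizability

end
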